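import Literature.NumberTheory.Transcendental.ZudilinLemma19
import Literature.NumberTheory.Transcendental.ZudilinOddZetaComplex
import HarnessLib

/-!
# Zudilin's linear forms `Sₙ ∈ ℚ + ℚζ(5) + ℚζ(7) + ℚζ(9) + ℚζ(11)` and their arithmetic

Topic `Literature/NumberTheory/Transcendental`. The real-analytic end of **[Zudilin2004, Lemma 19]**
at the parameters of Theorem 3, for `Sₙ = ½ ∑_{k ≥ 1} Rₙ''(k)` (`Zudilin2004.S`, file
`ZudilinOddZeta.lean`):

* `Zudilin2004.R_eq_pfSumR` — the partial-fraction expansion of `Rₙ` over `ℝ` on `(0, ∞)`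
  (transferred from `ℚ`, `ZudilinCoefficients.lean`, by density of `ℚ` and continuity);
* `Zudilin2004.iteratedDeriv_two_R` — `Rₙ''(k) = ∑_{i,s} B n s i · s(s+1) (k+i)^{-s-2}` for `k > 0`;
* `Zudilin2004.sum_B_one_eq_zero` — the residues sum to zero, `∑_i B n 1 i = 0` (`Rₙ(k) = O(k⁻²)`,
  [Zudilin2004, (8.3)]; here from `k Rₙ(k) → 0`, using the decay bound of
  `ZudilinOddZetaComplex.lean`), so `ζ(3)` does not occur;
* `Zudilin2004.S_eq` — `Sₙ = ∑_{s=1}^{10} qZeta n s · ζ(s+2) + qConst n`, and with the vanishing of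
  the coefficients for `s = 1` and even `s`:
* `Zudilin2004.linearForms_arith` — **for `n ≥ 1` there are integers `a₀,…,a₄` with
  `2 D_{35n}³ D_{34n} D_{33n}⁸ · Sₙ = Φₙ (a₀ + a₁ ζ(5) + a₂ ζ(7) + a₃ ζ(9) + a₄ ζ(11))`**, i.e. exactly
  the hypothesis `harith` of the gluing theorem `Zudilin2004.zudilin_of_linearForms`
  ([Zudilin2004, Lemma 19]: `D_{m₁}^r ⋯ D_{m_{q-r}} Φ⁻¹ F(h) ∈ ℤζ(q-2) + ⋯ + ℤζ(r+2) + ℤ`;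
  [Fischler2004, §3.3]).

Everything here is PROVED (no named facts). What remains for `zudilin_holds` are the analytic
inputs of the gluing theorem: the decay and non-vanishing of `Sₙ` ([Zudilin2004, Lemma 20]) and
the growth of `Φₙ`.

## References

* [Zudilin2004] W. Zudilin, *Arithmetic of linear forms involving odd zeta values*, J. Théor.
  Nombres Bordeaux 16 (2004), 251–291, §8 Lemma 19.
* [Fischler2004] S. Fischler, Sém. Bourbaki exp. 910, Astérisque 294 (2004), §3.3.
-/

noncomputable section

open Finset Filter Topology Literature.Analysis.Calculus
open scoped Nat

namespace Literature.NumberTheory.Transcendental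

namespace Zudilin2004

/-! ### From `ℚ` to `ℝ` -/

/-- `(Rₙ(q) : ℝ) = Rₙ(q : ℝ)` for rational `q`. [cite: Zudilin2004, §8 (8.7)] -/
theorem cast_R (n : ℕ) (q : ℚ) : ((R n q : ℚ) : ℝ) = R n (q : ℝ) := by
  unfold R
  push_cast
  ring

/-- The real partial-fraction sum `∑_{i=2n}^{35n} ∑_{s=1}^{10} B n s i (k+i)^{-s}`. [cite: Zudilin2004, §8 Lemma 19 (proof)] -/
def pfSumR (n : ℕ) (k : ℝ) : ℝ :=
  ∑ i ∈ poleSet n, ∑ s ∈ Icc 1 10, (B n s i : ℝ) * ((k + i) ^ s)⁻¹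

/-- The expansion at positive rationals. [cite: Zudilin2004, §8 Lemma 19 (proof)] -/
theorem R_eq_pfSumR_rat (n : ℕ) {q : ℚ} (hq : 0 < q) : R n (q : ℝ) = pfSumR n q := by
  have hgood : ∀ i ∈ poleSet n, (q : ℚ) + i ≠ 0 := fun i _ => by positivity
  rw [← cast_R, R_eq_sum_B n q hgood, pfSumR]
  push_cast
  rfl

/-- Continuity of the real `Rₙ` at positive points. [folklore] -/
theorem continuousAt_R (n : ℕ) {k : ℝ} (hk : 0 < k) : ContinuousAt (R n) k := by
  unfold R
  refine ContinuousAt.div (by fun_prop) (by fun_prop) ?_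
  refine prod_ne_zero_iff.2 fun u _ => prod_ne_zero_iff.2 fun i _ => ?_
  positivity

/-- Smoothness of `(k+i)^{-s}` at positive points. [folklore] -/
theorem contDiffAt_inv_pow_real (i s : ℕ) {k : ℝ} (hk : 0 < k) {N : WithTop ℕ∞} :
    ContDiffAt ℝ N (fun y : ℝ => ((y + i) ^ s)⁻¹) k := by
  refine ((contDiffAt_id.add contDiffAt_const).pow s).inv ?_
  simp only [id]
  positivity

/-- Continuity of the partial-fraction sum at positive points. [folklore] -/
theorem contDiffAt_pfSumR (n : ℕ) {k : ℝ} (hk : 0 < k) {N : WithTop ℕ∞} :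
    ContDiffAt ℝ N (pfSumR n) k := by
  unfold pfSumR
  refine ContDiffAt.sum fun i _ => ContDiffAt.sum fun s _ => ?_
  exact contDiffAt_const.mul (contDiffAt_inv_pow_real i s hk)

/-- **Partial fractions of `Rₙ` over `ℝ`**: `Rₙ(k) = ∑_{i,s} B n s i (k+i)^{-s}` for real `k > 0`
(from the rational identity by density of `ℚ` and continuity). [cite: Zudilin2004, §8 Lemma 19 (proof)] -/
theorem R_eq_pfSumR (n : ℕ) {k : ℝ} (hk : 0 < k) : R n k = pfSumR n k := by
  set f : ℝ → ℝ := fun y => R n y - pfSumR n y with hf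
  have hfc : ContinuousAt f k := (continuousAt_R n hk).sub (contDiffAt_pfSumR n hk (N := 0)).continuousAt
  haveI : (𝓝[Set.range ((↑) : ℚ → ℝ)] k).NeBot := Rat.denseRange_cast.nhdsWithin_neBot k
  have h1 : Tendsto f (𝓝[Set.range ((↑) : ℚ → ℝ)] k) (𝓝 (f k)) :=
    hfc.tendsto.mono_left nhdsWithin_le_nhds
  have h2 : f =ᶠ[𝓝[Set.range ((↑) : ℚ → ℝ)] k] fun _ => 0 := by
    have hpos : ∀ᶠ y in 𝓝[Set.range ((↑) : ℚ → ℝ)] k, 0 < y :=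
      mem_nhdsWithin_of_mem_nhds (Ioi_mem_nhds hk)
    filter_upwards [hpos, self_mem_nhdsWithin] with y hy hmem
    obtain ⟨q, rfl⟩ := hmem
    have hq : (0 : ℚ) < q := by exact_mod_cast hy
    simp only [hf, R_eq_pfSumR_rat n hq, sub_self]
  have := tendsto_nhds_unique (h1.congr' h2) tendsto_const_nhds
  simp only [hf] at this
  linarith

/-! ### The second derivative -/

/-- `(d/dy)² (y+i)^{-s} = s(s+1) (y+i)^{-s-2}` at `y = k > 0`. [folklore] -/
theorem iteratedDeriv_two_inv_pow (i s : ℕ) {k : ℝ} (hk : 0 < k) :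
    iteratedDeriv 2 (fun y : ℝ => ((y + i) ^ s)⁻¹) k = (s : ℝ) * (s + 1) * ((k + i) ^ (s + 2))⁻¹ := by
  have hfun : (fun y : ℝ => ((y + i) ^ s)⁻¹) = fun y => (fun x : ℝ => x ^ (-(s : ℤ))) (y + i) := by
    funext y
    simp only [zpow_neg, zpow_natCast]
  rw [hfun, iteratedDeriv_comp_add_const 2 (fun x : ℝ => x ^ (-(s : ℤ))) (i : ℝ)]
  simp only
  rw [iteratedDeriv_eq_iterate, iter_deriv_zpow]
  have hk' : (k + i : ℝ) ≠ 0 := by positivity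
  rw [show (-(s : ℤ) - (2 : ℕ)) = -((s + 2 : ℕ) : ℤ) by push_cast; ring, zpow_neg, zpow_natCast]
  simp [Finset.prod_range_succ]
  ring

/-- **`Rₙ''(k)` through the partial fractions**: for real `k > 0`,
`Rₙ''(k) = ∑_{i,s} B n s i · s(s+1) (k+i)^{-s-2}`. [cite: Zudilin2004, §8 Lemma 19 (proof)] -/
theorem iteratedDeriv_two_R (n : ℕ) {k : ℝ} (hk : 0 < k) :
    iteratedDeriv 2 (R n) k =
      ∑ i ∈ poleSet n, ∑ s ∈ Icc 1 10, (B n s i : ℝ) * ((s : ℝ) * (s + 1)) * ((k + i) ^ (s + 2))⁻¹ := by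
  have heq : (R n : ℝ → ℝ) =ᶠ[𝓝 k] pfSumR n :=
    Filter.eventuallyEq_of_mem (Ioi_mem_nhds hk) fun y hy => R_eq_pfSumR n hy
  rw [heq.iteratedDeriv_eq]
  unfold pfSumR
  rw [iteratedDeriv_fun_sum fun i _ =>
    ContDiffAt.sum fun s _ => contDiffAt_const.mul (contDiffAt_inv_pow_real i s hk)]
  refine sum_congr rfl fun i _ => ?_
  rw [iteratedDeriv_fun_sum fun s _ => contDiffAt_const.mul (contDiffAt_inv_pow_real i s hk)]
  refine sum_congr rfl fun s _ => ?_
  rw [iteratedDeriv_const_mul _ (contDiffAt_inv_pow_real i s hk), iteratedDeriv_two_inv_pow i s hk]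
  ring

/-! ### The residues sum to zero -/

/-- `k (k+i)^{-s} → [s = 1]` as `k → ∞`. [folklore] -/
theorem tendsto_mul_inv_pow (i : ℕ) {s : ℕ} (hs : 1 ≤ s) :
    Tendsto (fun k : ℝ => k * ((k + i) ^ s)⁻¹) atTop (𝓝 (if s = 1 then 1 else 0)) := by
  -- `k/(k+i) → 1`
  have h1 : Tendsto (fun k : ℝ => k * (k + i)⁻¹) atTop (𝓝 1) := by
    have h : Tendsto (fun k : ℝ => 1 - (i : ℝ) * (k + i)⁻¹) atTop (𝓝 (1 - 0)) := by
      refine tendsto_const_nhds.sub ?_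
      have := (tendsto_const_nhds (x := (i : ℝ))).div_atTop
        (tendsto_atTop_add_const_right atTop (i : ℝ) tendsto_id)
      simpa [div_eq_mul_inv] using this
    rw [sub_zero] at h
    refine h.congr' ?_
    filter_upwards [eventually_gt_atTop 0] with k hk
    have : (k + i : ℝ) ≠ 0 := by positivity
    field_simp
    ring
  rcases hs.eq_or_lt with rfl | hs'
  · simpa using h1
  · rw [if_neg (by omega)]
    -- `k (k+i)^{-s} = (k/(k+i)) · (k+i)^{-(s-1)}` and the second factor tends to `0`
    have h2 : Tendsto (fun k : ℝ => ((k + i) ^ (s - 1))⁻¹) atTop (𝓝 0) :=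
      ((tendsto_pow_atTop (by omega : s - 1 ≠ 0)).comp
        (tendsto_atTop_add_const_right atTop (i : ℝ) tendsto_id)).inv_tendsto_atTop
    have := h1.mul h2
    rw [one_mul] at this
    refine this.congr' ?_
    filter_upwards [eventually_gt_atTop 0] with k hk
    have : (k + i : ℝ) ≠ 0 := by positivity
    have hs2 : (k + i : ℝ) ^ s = (k + i) ^ (s - 1) * (k + i) := by
      rw [← pow_succ]; congr 1; omega
    rw [hs2, mul_inv]
    ring

/-- `k Rₙ(k) → 0` as `k → ∞` (real `k`; `n ≥ 1`), from the decay bound `‖Rₙ(k)‖ ≤ C/(1+‖k‖²)`.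
[cite: Zudilin2004, §8 (8.3)] -/
theorem tendsto_mul_R {n : ℕ} (hn : 1 ≤ n) : Tendsto (fun k : ℝ => k * R n k) atTop (𝓝 0) := by
  set C : ℝ := 8 * |(normConst n : ℝ)| * 64 ^ (162 * n + 1) with hC
  have hC0 : 0 ≤ C := by positivity
  have hbound : ∀ᶠ k : ℝ in atTop, ‖k * R n k‖ ≤ C * k⁻¹ := by
    filter_upwards [eventually_gt_atTop 0] with k hk
    have h := norm_R_le hn (k := (k : ℂ)) (by simp; linarith)
    rw [← ofReal_R, Complex.norm_real, Complex.norm_real, Real.norm_eq_abs] at h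
    rw [norm_mul, Real.norm_eq_abs, abs_of_pos hk, Real.norm_eq_abs]
    have hk2 : |R n k| ≤ C / (1 + k ^ 2) := by simpa [hC, abs_of_pos hk] using h
    calc k * |R n k| ≤ k * (C / (1 + k ^ 2)) := by gcongr
      _ ≤ C * k⁻¹ := by
        rw [div_eq_mul_inv, mul_left_comm]
        refine mul_le_mul_of_nonneg_left ?_ hC0
        rw [← div_eq_mul_inv, div_le_iff₀ (by positivity), inv_mul_eq_div, le_div_iff₀ hk]
        nlinarith
  refine squeeze_zero_norm' hbound ?_
  simpa using (tendsto_const_nhds (x := C)).mul tendsto_inv_atTop_zero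

/-- `k · pfSumR n k → ∑_i B n 1 i` as `k → ∞`. [folklore] -/
theorem tendsto_mul_pfSumR (n : ℕ) :
    Tendsto (fun k : ℝ => k * pfSumR n k) atTop (𝓝 (∑ i ∈ poleSet n, (B n 1 i : ℝ))) := by
  have h : Tendsto (fun k : ℝ => ∑ i ∈ poleSet n, ∑ s ∈ Icc 1 10, (B n s i : ℝ) * (k * ((k + i) ^ s)⁻¹))
      atTop (𝓝 (∑ i ∈ poleSet n, ∑ s ∈ Icc 1 10, (B n s i : ℝ) * (if s = 1 then 1 else 0))) := by
    refine tendsto_finsetSum _ fun i _ => tendsto_finsetSum _ fun s hs => ?_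
    exact (tendsto_mul_inv_pow i (mem_Icc.1 hs).1).const_mul _
  have hval : ∑ i ∈ poleSet n, ∑ s ∈ Icc 1 10, (B n s i : ℝ) * (if s = 1 then (1 : ℝ) else 0)
      = ∑ i ∈ poleSet n, (B n 1 i : ℝ) := by
    refine sum_congr rfl fun i _ => ?_
    simp only [mul_ite, mul_one, mul_zero]
    rw [sum_ite_eq']
    simp
  rw [hval] at h
  refine h.congr fun k => ?_
  simp only [pfSumR, mul_sum]
  exact sum_congr rfl fun i _ => sum_congr rfl fun s _ => by ring

/-- **The residues sum to zero**: `∑_{i=2n}^{35n} B n 1 i = 0` (`n ≥ 1`), i.e. `ζ(3)` does not occur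
in `Sₙ` ([Zudilin2004, proof of Lemma 19]: `A_r = 0` by (8.3)). [cite: Zudilin2004, §8 Lemma 19 (proof)] -/
theorem sum_B_one_eq_zero {n : ℕ} (hn : 1 ≤ n) : ∑ i ∈ poleSet n, B n 1 i = 0 := by
  have h1 := tendsto_mul_R hn
  have h2 := tendsto_mul_pfSumR n
  have heq : (fun k : ℝ => k * R n k) =ᶠ[atTop] fun k => k * pfSumR n k := by
    filter_upwards [eventually_gt_atTop 0] with k hk
    rw [R_eq_pfSumR n hk]
  have := tendsto_nhds_unique (h1.congr' heq) h2
  exact_mod_cast this.symm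

/-! ### Summation: `Sₙ` as a linear form in zeta values -/

/-- `∑_{k ≥ 0} (k+1+i)^{-m} = ζ(m) - H_i^{(m)}` for `m ≥ 2`. [folklore] -/
theorem hasSum_inv_pow_shift (i : ℕ) {m : ℕ} (hm : 2 ≤ m) :
    HasSum (fun k : ℕ => (((k : ℝ) + 1 + i) ^ m)⁻¹) (zetaValue m - (Hsum i m : ℝ)) := by
  set f : ℕ → ℝ := fun l => 1 / (l : ℝ) ^ m with hf
  have hsum : Summable f := Real.summable_one_div_nat_pow.2 (by omega)
  have hz : HasSum f (zetaValue m) := hsum.hasSum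
  have hshift : HasSum (fun k => f (k + (i + 1))) (zetaValue m - ∑ j ∈ range (i + 1), f j) :=
    (hasSum_nat_add_iff (i + 1)).2 (by rwa [sub_add_cancel])
  have hH : ∑ j ∈ range (i + 1), f j = (Hsum i m : ℝ) := by
    rw [sum_range_succ']
    simp only [hf, Nat.cast_zero, zero_pow (by omega : m ≠ 0), div_zero, add_zero, Hsum,
      Rat.cast_sum, Rat.cast_inv, Rat.cast_pow, Rat.cast_natCast]
    rw [show Icc 1 i = Ico 1 (i + 1) by rfl, sum_Ico_eq_sum_range, Nat.add_sub_cancel]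
    refine sum_congr rfl fun j _ => ?_
    push_cast
    rw [one_div]
    ring
  rw [hH] at hshift
  convert hshift using 1
  funext k
  simp only [hf]
  push_cast
  rw [one_div]
  ring

/-- **`Sₙ` as a linear form**: `Sₙ = ∑_{s=1}^{10} qZeta n s · ζ(s+2) + qConst n`.
[cite: Zudilin2004, §8 Lemma 19] -/
theorem S_eq (n : ℕ) : S n = ∑ s ∈ Icc 1 10, (qZeta n s : ℝ) * zetaValue (s + 2) + (qConst n : ℝ) := by
  -- the summand of `S n`
  have hterm : ∀ k : ℕ, iteratedDeriv 2 (R n) ((k : ℝ) + 1)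
      = ∑ i ∈ poleSet n, ∑ s ∈ Icc 1 10,
          (B n s i : ℝ) * ((s : ℝ) * (s + 1)) * ((((k : ℝ) + 1 + i) ^ (s + 2)))⁻¹ := by
    intro k
    rw [iteratedDeriv_two_R n (by positivity)]
  have hHas : HasSum (fun k : ℕ => iteratedDeriv 2 (R n) ((k : ℝ) + 1))
      (∑ i ∈ poleSet n, ∑ s ∈ Icc 1 10,
        (B n s i : ℝ) * ((s : ℝ) * (s + 1)) * (zetaValue (s + 2) - (Hsum i (s + 2) : ℝ))) := by
    simp_rw [hterm]
    refine hasSum_sum fun i _ => hasSum_sum fun s hs => ?_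
    exact (hasSum_inv_pow_shift i (by omega)).mul_left _
  unfold S
  rw [hHas.tsum_eq]
  -- regroup
  have hchoose : ∀ s : ℕ, ((s : ℝ) * (s + 1)) = 2 * ((s + 1).choose 2 : ℕ) := by
    intro s
    have h := Nat.choose_two_right (s + 1)
    have h2 : 2 * (s + 1).choose 2 = (s + 1) * s := by
      rw [h, Nat.two_mul_div_two_of_even (Nat.even_mul_pred_self (s + 1))]
      simp
    have : (2 : ℝ) * ((s + 1).choose 2 : ℕ) = ((s + 1 : ℕ) : ℝ) * s := by exact_mod_cast h2
    rw [this]; push_cast; ring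
  have eL : (1 / 2 : ℝ) * ∑ i ∈ poleSet n, ∑ s ∈ Icc 1 10,
        (B n s i : ℝ) * ((s : ℝ) * (s + 1)) * (zetaValue (s + 2) - (Hsum i (s + 2) : ℝ))
      = ∑ i ∈ poleSet n, ∑ s ∈ Icc 1 10, ((s + 1).choose 2 : ℝ) * (B n s i : ℝ) * zetaValue (s + 2)
        - ∑ i ∈ poleSet n, ∑ s ∈ Icc 1 10, ((s + 1).choose 2 : ℝ) * (B n s i : ℝ) * (Hsum i (s + 2) : ℝ) := by
    rw [mul_sum, ← sum_sub_distrib]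
    refine sum_congr rfl fun i _ => ?_
    rw [mul_sum, ← sum_sub_distrib]
    refine sum_congr rfl fun s _ => ?_
    rw [hchoose s]
    ring
  have eR : ∑ s ∈ Icc 1 10, (qZeta n s : ℝ) * zetaValue (s + 2) + (qConst n : ℝ)
      = ∑ i ∈ poleSet n, ∑ s ∈ Icc 1 10, ((s + 1).choose 2 : ℝ) * (B n s i : ℝ) * zetaValue (s + 2)
        - ∑ i ∈ poleSet n, ∑ s ∈ Icc 1 10, ((s + 1).choose 2 : ℝ) * (B n s i : ℝ) * (Hsum i (s + 2) : ℝ) := by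
    simp only [qZeta, qConst, Rat.cast_mul, Rat.cast_natCast, Rat.cast_sum, Rat.cast_neg,
      ← sub_eq_add_neg]
    congr 1
    rw [sum_comm]
    refine sum_congr rfl fun s _ => ?_
    rw [mul_sum, sum_mul]
  rw [eL]
  exact eR.symm

/-! ### The arithmetic of the linear forms -/

/-- The coefficient of `ζ(s+2)` vanishes for `s = 1` (residues) and for even `s` (well-poised
symmetry). [cite: Zudilin2004, §8 Lemma 19 (proof)] -/
theorem qZeta_eq_zero {n : ℕ} (hn : 1 ≤ n) {s : ℕ} (hs : s ≤ 10) (h : s = 1 ∨ Even s) :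
    qZeta n s = 0 := by
  unfold qZeta
  rcases h with rfl | heven
  · rw [sum_B_one_eq_zero hn, mul_zero]
  · rw [sum_B_eq_zero_of_even n hs heven, mul_zero]

/-- **Arithmetic of Zudilin's linear forms** ([Zudilin2004, Lemma 19] at the parameters of
Theorem 3, normalisation of [Fischler2004, §3.3]): for `n ≥ 1` there are integers `a₀, …, a₄` with
`2 D_{35n}³ D_{34n} D_{33n}⁸ · Sₙ = Φₙ (a₀ + a₁ ζ(5) + a₂ ζ(7) + a₃ ζ(9) + a₄ ζ(11))` — the hypothesis
`harith` of `Zudilin2004.zudilin_of_linearForms`. [cite: Zudilin2004, §8 Lemma 19] -/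
theorem linearForms_arith (n : ℕ) (hn : 1 ≤ n) : ∃ a : Fin 5 → ℤ,
    2 * (D n : ℝ) * S n = Phi n * (a 0 + a 1 * zetaValue 5 + a 2 * zetaValue 7 +
      a 3 * zetaValue 9 + a 4 * zetaValue 11) := by
  obtain ⟨z3, hz3⟩ := qZeta_integral hn (s := 3) (by simp)
  obtain ⟨z5, hz5⟩ := qZeta_integral hn (s := 5) (by simp)
  obtain ⟨z7, hz7⟩ := qZeta_integral hn (s := 7) (by simp)
  obtain ⟨z9, hz9⟩ := qZeta_integral hn (s := 9) (by simp)
  obtain ⟨z0, hz0⟩ := qConst_integral hn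
  refine ⟨![2 * z0, 2 * z3, 2 * z5, 2 * z7, 2 * z9], ?_⟩
  have h1 := qZeta_eq_zero hn (s := 1) (by norm_num) (Or.inl rfl)
  have h2 := qZeta_eq_zero hn (s := 2) (by norm_num) (Or.inr (by decide))
  have h4 := qZeta_eq_zero hn (s := 4) (by norm_num) (Or.inr (by decide))
  have h6 := qZeta_eq_zero hn (s := 6) (by norm_num) (Or.inr (by decide))
  have h8 := qZeta_eq_zero hn (s := 8) (by norm_num) (Or.inr (by decide))
  have h10 := qZeta_eq_zero hn (s := 10) (by norm_num) (Or.inr (by decide))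
  -- cast the rational identities to `ℝ`
  have c3 : (D n : ℝ) * (qZeta n 3 : ℝ) = Phi n * z3 := by exact_mod_cast hz3
  have c5 : (D n : ℝ) * (qZeta n 5 : ℝ) = Phi n * z5 := by exact_mod_cast hz5
  have c7 : (D n : ℝ) * (qZeta n 7 : ℝ) = Phi n * z7 := by exact_mod_cast hz7
  have c9 : (D n : ℝ) * (qZeta n 9 : ℝ) = Phi n * z9 := by exact_mod_cast hz9
  have c0 : (D n : ℝ) * (qConst n : ℝ) = Phi n * z0 := by exact_mod_cast hz0
  rw [S_eq n, show Icc 1 10 = {1, 2, 3, 4, 5, 6, 7, 8, 9, 10} by rfl]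
  rw [sum_insert (by decide), sum_insert (by decide), sum_insert (by decide), sum_insert (by decide),
    sum_insert (by decide), sum_insert (by decide), sum_insert (by decide), sum_insert (by decide),
    sum_insert (by decide), sum_singleton, h1, h2, h4, h6, h8, h10]
  simp only [Rat.cast_zero, zero_mul, zero_add, add_zero, Matrix.cons_val_zero, Matrix.cons_val_one,
    Matrix.cons_val]
  norm_num
  linear_combination 2 * zetaValue 5 * c3 + 2 * zetaValue 7 * c5 + 2 * zetaValue 9 * c7 +
    2 * zetaValue 11 * c9 + 2 * c0

end Zudilin2004

end Literature.NumberTheory.Transcendental
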